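import Mathlib.LinearAlgebra.TensorProduct.Basis
import Mathlib.RingTheory.TensorProduct.Finite
import Mathlib.LinearAlgebra.Dimension.Constructions
import Mathlib.LinearAlgebra.Dual.Lemmas
import Mathlib.LinearAlgebra.Eigenspace.Basic
import Mathlib.LinearAlgebra.FiniteDimensional.Lemmas
import HarnessLib

/-!
# A pure tensor `g₂ ⊗ h` on `V₂ ⊗ V′` (`dim V₂ = 2`, `dim V′ ≥ 3`) is never a bireflection with a simple eigenvalue
(case (d2) of the Hodge cell's lemma BL: the `𝔰𝔩₂ ⊗ 1 + 1 ⊗ 𝔥` branch of Katz's Remark 1.4.1 carries no `(i, −i)`-bireflection)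

Elementary linear algebra over a field `K`:
* `compo b j` — the component maps `V₂ ⊗ V′ → V′` of a basis `b` of `V₂` (`x = Σⱼ bⱼ ⊗ compo b j x`);
* **`exists_eq_smul_id_of_fixed`** (slice count) — if `g₂ ⊗ h` (`h` invertible) fixes pointwise a subspace `W` with
  `dim(V₂ ⊗ V′) ≤ dim W + 2` and `dim V′ ≥ 3`, `dim V₂ = 2`, then `g₂` is a scalar: every slice `a ⊗ V′` (dimension `dim V′`)
  meets `W`, giving `g₂ a ⊗ h y = a ⊗ y` with `y ≠ 0`, whence `g₂ a ∈ K a`;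
* **`two_le_finrank_eigenspace_map_one`** — a non-zero eigenspace of `1 ⊗ h′` has dimension `≥ 2` (with `x = Σ bⱼ ⊗ yⱼ` an
  eigenvector, some `yⱼ ≠ 0` is an eigenvector of `h′`, and `b₀ ⊗ yⱼ, b₁ ⊗ yⱼ` are independent eigenvectors);
* **`false_of_conj_tensor_of_finrank_eigenspace_eq_one`** — hence no `γ ≅ g₂ ⊗ h` (under any `V ≃ V₂ ⊗ V′`) fixes a subspace of
  codimension `≤ 2` while having a `1`-dimensional eigenspace. For an `(i, −i)`-bireflection (`γ = 1` on `U` of codimension 2,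
  `E_i(γ) = K v₊`) this is the contradiction closing branch (d2).
THEOREMS (+ the definition `compo`); for crux K1Q. [cite: Katz1990ESDE, Ch. 1, Remark 1.4.1 (p. 10)]
-/

namespace Literature.Algebra.Lie

namespace TensorObstruction

open Module TensorProduct
open scoped TensorProduct

variable {K : Type*} [Field K] {V₂ : Type*} [AddCommGroup V₂] [Module K V₂] {V' : Type*} [AddCommGroup V'] [Module K V']

/-- The `j`-th component map `V₂ ⊗ V′ → V′` attached to a basis `b` of `V₂`: `a ⊗ y ↦ b.repr a j • y`.
[cite: Katz1990ESDE, Ch. 1, Remark 1.4.1 (p. 10)] -/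
noncomputable def compo {ι : Type*} (b : Basis ι K V₂) (j : ι) : V₂ ⊗[K] V' →ₗ[K] V' :=
  (TensorProduct.lid K V').toLinearMap ∘ₗ TensorProduct.map (b.coord j) LinearMap.id

/-- `compo b j (a ⊗ y) = (b.repr a j) • y`. [cite: Katz1990ESDE, Ch. 1, Remark 1.4.1 (p. 10)] -/
@[simp]
theorem compo_tmul {ι : Type*} (b : Basis ι K V₂) (j : ι) (a : V₂) (y : V') : compo b j (a ⊗ₜ[K] y) = b.repr a j • y := by
  simp [compo]

/-- `compo` intertwines `1 ⊗ h′` with `h′`. [cite: Katz1990ESDE, Ch. 1, Remark 1.4.1 (p. 10)] -/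
theorem compo_map_one {ι : Type*} (b : Basis ι K V₂) (j : ι) (h' : V' →ₗ[K] V') (x : V₂ ⊗[K] V') :
    compo b j (TensorProduct.map LinearMap.id h' x) = h' (compo b j x) := by
  induction x using TensorProduct.induction_on with
  | zero => simp
  | tmul a y => simp [map_smul]
  | add x y hx hy => simp [map_add, hx, hy]

/-- `compo` against a general pure tensor map: `compo b j ((g₂ ⊗ h) (a ⊗ y)) = b.repr (g₂ a) j • h y`.
[cite: Katz1990ESDE, Ch. 1, Remark 1.4.1 (p. 10)] -/
theorem compo_map_tmul {ι : Type*} (b : Basis ι K V₂) (j : ι) (g₂ : V₂ →ₗ[K] V₂) (h : V' →ₗ[K] V') (a : V₂) (y : V') :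
    compo b j (TensorProduct.map g₂ h (a ⊗ₜ[K] y)) = b.repr (g₂ a) j • h y := by
  simp

/-- **Reconstruction**: `x = Σⱼ bⱼ ⊗ compo b j x`. [cite: Katz1990ESDE, Ch. 1, Remark 1.4.1 (p. 10)] -/
theorem sum_tmul_compo {ι : Type*} [Fintype ι] (b : Basis ι K V₂) (x : V₂ ⊗[K] V') : ∑ j, b j ⊗ₜ[K] compo b j x = x := by
  induction x using TensorProduct.induction_on with
  | zero => simp
  | tmul a y =>
    simp only [compo_tmul, TensorProduct.tmul_smul]
    conv_rhs => rw [← b.sum_repr a]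
    rw [TensorProduct.sum_tmul]
    simp only [TensorProduct.smul_tmul']
  | add x y hx hy => simp only [map_add, TensorProduct.tmul_add, Finset.sum_add_distrib, hx, hy]

/-- A pure tensor `a ⊗ y` with `a ≠ 0` vanishes only if `y = 0`. [cite: Katz1990ESDE, Ch. 1, Remark 1.4.1 (p. 10)] -/
theorem eq_zero_of_tmul_eq_zero [FiniteDimensional K V₂] {a : V₂} (ha : a ≠ 0) {y : V'} (h : a ⊗ₜ[K] y = 0) : y = 0 := by
  classical
  let b := Module.finBasis K V₂
  obtain ⟨j, hj⟩ : ∃ j, b.repr a j ≠ 0 := by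
    by_contra hall
    push Not at hall
    exact ha (b.repr.injective (by ext j; simp [hall j]))
  have := congrArg (compo b j) h
  rw [compo_tmul, map_zero] at this
  exact (smul_eq_zero.1 this).resolve_left hj

/-- Every vector an eigenvector ⇒ scalar operator. [cite: Katz1990ESDE, Ch. 1, Remark 1.4.1 (p. 10)] -/
theorem exists_eq_smul_id_of_forall_mem_span {g : V₂ →ₗ[K] V₂} (hg : ∀ a : V₂, g a ∈ K ∙ a) :
    ∃ c : K, g = c • LinearMap.id := by
  classical
  rcases subsingleton_or_nontrivial V₂ with hV | hV
  · exact ⟨0, by ext a; simp [Subsingleton.elim a 0]⟩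
  obtain ⟨a₀, ha₀⟩ := exists_ne (0 : V₂)
  obtain ⟨c, hc⟩ := Submodule.mem_span_singleton.1 (hg a₀)
  refine ⟨c, LinearMap.ext fun a => ?_⟩
  rw [LinearMap.smul_apply, LinearMap.id_apply]
  obtain ⟨d, hd⟩ := Submodule.mem_span_singleton.1 (hg a)
  by_cases hlin : ∃ t : K, a = t • a₀
  · obtain ⟨t, rfl⟩ := hlin
    rw [map_smul, ← hc, smul_comm]
  · -- `a₀, a` independent: compare `g (a₀ + a) = e (a₀ + a)` with `c a₀ + d a`
    obtain ⟨e, he⟩ := Submodule.mem_span_singleton.1 (hg (a₀ + a))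
    have hsum : (e - c) • a₀ + (e - d) • a = 0 := by
      have := he
      rw [map_add, ← hc, ← hd, smul_add] at this
      rw [sub_smul, sub_smul]
      have h' := sub_eq_zero.2 this
      convert h' using 1
      abel
    have hli : LinearIndependent K ![a₀, a] := by
      refine LinearIndependent.pair_iff.2 fun s t hst => ?_
      by_cases ht : t = 0
      · subst ht; simp only [zero_smul, add_zero, smul_eq_zero] at hst
        exact ⟨hst.resolve_right ha₀, rfl⟩
      · exfalso; apply hlin
        refine ⟨-(t⁻¹ * s), ?_⟩
        have : t • a = -(s • a₀) := eq_neg_of_add_eq_zero_right hst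
        calc a = t⁻¹ • (t • a) := by rw [smul_smul, inv_mul_cancel₀ ht, one_smul]
          _ = -(t⁻¹ * s) • a₀ := by rw [this, smul_neg, smul_smul, neg_smul]
    have h0 := (LinearIndependent.pair_iff.1 hli) (e - c) (e - d) hsum
    have hed : e = d := sub_eq_zero.1 h0.2
    have hec : e = c := sub_eq_zero.1 h0.1
    rw [← hd, ← hed, hec]

section Slice

variable [FiniteDimensional K V₂] [FiniteDimensional K V']

/-- **Slice count: a pure tensor `g₂ ⊗ h` (`h` invertible) fixing pointwise a subspace of codimension `≤ 2` of `V₂ ⊗ V′`,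
`dim V₂ = 2`, `dim V′ ≥ 3`, has `g₂` scalar.** [cite: Katz1990ESDE, Ch. 1, Remark 1.4.1 (p. 10)] -/
theorem exists_eq_smul_id_of_fixed (g₂ : V₂ →ₗ[K] V₂) (h : V' ≃ₗ[K] V') (W : Submodule K (V₂ ⊗[K] V'))
    (hW : ∀ x ∈ W, TensorProduct.map g₂ (h : V' →ₗ[K] V') x = x) (hdim : finrank K (V₂ ⊗[K] V') ≤ finrank K W + 2)
    (h2 : finrank K V₂ = 2) (hk : 3 ≤ finrank K V') : ∃ c : K, g₂ = c • LinearMap.id := by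
  refine exists_eq_smul_id_of_forall_mem_span fun a => ?_
  by_cases ha : a = 0
  · rw [ha, map_zero]; exact Submodule.zero_mem _
  -- the slice `a ⊗ V′`
  let S : Submodule K (V₂ ⊗[K] V') := LinearMap.range (TensorProduct.mk K V₂ V' a)
  have hSinj : Function.Injective (TensorProduct.mk K V₂ V' a) := by
    intro y y' hyy
    have : a ⊗ₜ[K] (y - y') = 0 := by rw [TensorProduct.tmul_sub]; exact sub_eq_zero.2 hyy
    exact sub_eq_zero.1 (eq_zero_of_tmul_eq_zero ha this)
  have hS : finrank K S = finrank K V' := LinearMap.finrank_range_of_inj hSinj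
  have htot : finrank K (V₂ ⊗[K] V') = 2 * finrank K V' := by rw [Module.finrank_tensorProduct, h2]
  -- `S ⊓ W ≠ ⊥` by dimension
  have hne : S ⊓ W ≠ ⊥ := by
    intro hbot
    have h1 := Submodule.finrank_sup_add_finrank_inf_eq S W
    have h2' : finrank K ↥(S ⊔ W) ≤ finrank K (V₂ ⊗[K] V') := Submodule.finrank_le _
    rw [hbot, finrank_bot, add_zero, hS] at h1
    omega
  obtain ⟨x, hx, hx0⟩ := (Submodule.ne_bot_iff _).1 hne
  obtain ⟨⟨y, rfl⟩, hxW⟩ := hx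
  have hy : y ≠ 0 := by rintro rfl; exact hx0 (by simp)
  -- `g₂ a ⊗ h y = a ⊗ y`
  have hfix : g₂ a ⊗ₜ[K] h y = a ⊗ₜ[K] y := by
    have := hW _ hxW
    rwa [TensorProduct.mk_apply, TensorProduct.map_tmul] at this
  -- test against a functional `φ` with `φ (h y) ≠ 0`
  have hhy : h y ≠ 0 := fun h0 => hy (h.injective (by rw [h0, map_zero]))
  obtain ⟨φ, hφ⟩ : ∃ φ : Module.Dual K V', φ (h y) ≠ 0 := by
    by_contra hall
    push Not at hall
    exact hhy ((Module.forall_dual_apply_eq_zero_iff K (h y)).1 hall)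
  have := congrArg (fun z => TensorProduct.rid K V₂ (TensorProduct.map LinearMap.id φ z)) hfix
  simp only [TensorProduct.map_tmul, LinearMap.id_apply, TensorProduct.rid_tmul] at this
  -- `φ (h y) • g₂ a = φ y • a`
  rw [Submodule.mem_span_singleton]
  refine ⟨(φ (h y))⁻¹ * φ y, ?_⟩
  rw [mul_smul, ← this, smul_smul, inv_mul_cancel₀ hφ, one_smul]

end Slice

section Eigen

variable [FiniteDimensional K V₂] [FiniteDimensional K V']

/-- **A non-zero eigenspace of `1 ⊗ h′` (`dim V₂ = 2`) has dimension at least `2`.** [cite: Katz1990ESDE, Ch. 1, Remark 1.4.1 (p. 10)] -/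
theorem two_le_finrank_eigenspace_map_one (h' : V' →ₗ[K] V') (μ : K) (h2 : finrank K V₂ = 2)
    (hne : Module.End.eigenspace (TensorProduct.map (LinearMap.id : V₂ →ₗ[K] V₂) h') μ ≠ ⊥) :
    2 ≤ finrank K (Module.End.eigenspace (TensorProduct.map (LinearMap.id : V₂ →ₗ[K] V₂) h') μ) := by
  classical
  set T := TensorProduct.map (LinearMap.id : V₂ →ₗ[K] V₂) h' with hT
  obtain ⟨x, hx, hx0⟩ := (Submodule.ne_bot_iff _).1 hne
  let b : Basis (Fin 2) K V₂ := Module.finBasisOfFinrankEq K V₂ h2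
  -- some component of `x` is a non-zero `μ`-eigenvector of `h′`
  have hcomp : ∀ j, h' (compo b j x) = μ • compo b j x := fun j => by
    rw [Module.End.mem_eigenspace_iff] at hx
    rw [← compo_map_one, ← hT, hx, map_smul]
  obtain ⟨j, hj⟩ : ∃ j, compo b j x ≠ 0 := by
    by_contra hall
    push Not at hall
    apply hx0
    rw [← sum_tmul_compo b x]
    simp [hall]
  set y := compo b j x with hy
  -- the two eigenvectors `b 0 ⊗ y`, `b 1 ⊗ y`
  have hmem : ∀ l : Fin 2, b l ⊗ₜ[K] y ∈ Module.End.eigenspace T μ := fun l => by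
    rw [Module.End.mem_eigenspace_iff, hT, TensorProduct.map_tmul, LinearMap.id_apply, hcomp, TensorProduct.tmul_smul]
  have hli : LinearIndependent K (fun l : Fin 2 => (⟨b l ⊗ₜ[K] y, hmem l⟩ : Module.End.eigenspace T μ)) := by
    rw [Fintype.linearIndependent_iff]
    intro g hg l
    have hg' : ∑ l, g l • (b l ⊗ₜ[K] y) = 0 := by
      have := congrArg Subtype.val hg
      simpa only [Submodule.coe_sum, Submodule.coe_smul, Submodule.coe_zero] using this
    have := congrArg (compo b l) hg'
    simp only [map_sum, map_smul, compo_tmul, Basis.repr_self, Finsupp.single_apply, map_zero] at this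
    rw [Finset.sum_eq_single l (fun l' _ hl' => by simp [hl']) (by simp)] at this
    simp only [if_true, one_smul] at this
    exact (smul_eq_zero.1 this).resolve_right hj
  simpa using hli.fintype_card_le_finrank

/-- **No conjugate of a pure tensor `g₂ ⊗ h` (`dim V₂ = 2`, `dim V′ ≥ 3`) fixes a subspace of codimension `≤ 2` while having a
`1`-dimensional eigenspace** — in particular it is not an `(i, −i)`-bireflection. [cite: Katz1990ESDE, Ch. 1, Remark 1.4.1 (p. 10)] -/
theorem false_of_conj_tensor_of_finrank_eigenspace_eq_one {V : Type*} [AddCommGroup V] [Module K V] [FiniteDimensional K V]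
    (γ : V ≃ₗ[K] V) (e : V ≃ₗ[K] V₂ ⊗[K] V') (g₂ : V₂ →ₗ[K] V₂) (h : V' ≃ₗ[K] V')
    (hγ : ∀ v, e (γ v) = TensorProduct.map g₂ (h : V' →ₗ[K] V') (e v)) (U : Submodule K V) (hU : ∀ u ∈ U, γ u = u)
    (hUdim : finrank K V ≤ finrank K U + 2) {μ : K} (hμ : finrank K (Module.End.eigenspace (γ : Module.End K V) μ) = 1)
    (h2 : finrank K V₂ = 2) (hk : 3 ≤ finrank K V') : False := by
  -- `g₂` is a scalar by the slice count on `W = e(U)`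
  have hW : ∀ x ∈ U.map (e : V →ₗ[K] V₂ ⊗[K] V'), TensorProduct.map g₂ (h : V' →ₗ[K] V') x = x := by
    rintro _ ⟨u, hu, rfl⟩
    rw [LinearEquiv.coe_coe, ← hγ, hU u hu]
  have hdimW : finrank K (V₂ ⊗[K] V') ≤ finrank K (U.map (e : V →ₗ[K] V₂ ⊗[K] V')) + 2 := by
    rw [LinearEquiv.finrank_map_eq, ← e.finrank_eq]; exact hUdim
  obtain ⟨c, hc⟩ := exists_eq_smul_id_of_fixed g₂ h _ hW hdimW h2 hk
  -- so `γ ≅ 1 ⊗ (c h)`, whose eigenspaces have even dimension ≥ 2 when non-zero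
  set T := TensorProduct.map (LinearMap.id : V₂ →ₗ[K] V₂) (c • (h : V' →ₗ[K] V')) with hT
  have hγT : ∀ v, e (γ v) = T (e v) := fun v => by
    rw [hγ, hc, hT, TensorProduct.map_smul_left, TensorProduct.map_smul_right]
  -- `e` maps `E_μ(γ)` onto `E_μ(T)`
  have hmap : (Module.End.eigenspace (γ : Module.End K V) μ).map (e : V →ₗ[K] V₂ ⊗[K] V') = Module.End.eigenspace T μ := by
    apply le_antisymm
    · rintro _ ⟨v, hv, rfl⟩
      rw [SetLike.mem_coe, Module.End.mem_eigenspace_iff] at hv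
      change γ v = μ • v at hv
      rw [Module.End.mem_eigenspace_iff, LinearEquiv.coe_coe, ← hγT, hv, map_smul]
    · intro x hx
      refine ⟨e.symm x, ?_, e.apply_symm_apply x⟩
      rw [Module.End.mem_eigenspace_iff] at hx
      rw [SetLike.mem_coe, Module.End.mem_eigenspace_iff]
      change γ (e.symm x) = μ • e.symm x
      apply e.injective
      rw [hγT, LinearEquiv.apply_symm_apply, hx, map_smul, LinearEquiv.apply_symm_apply]
  have hfin : finrank K (Module.End.eigenspace T μ) = 1 := by rw [← hmap, LinearEquiv.finrank_map_eq]; exact hμ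
  have hne : Module.End.eigenspace T μ ≠ ⊥ := by
    intro h0; rw [h0, finrank_bot] at hfin; exact zero_ne_one hfin
  have h2le := two_le_finrank_eigenspace_map_one (c • (h : V' →ₗ[K] V')) μ h2 (by rw [← hT]; exact hne)
  rw [← hT] at h2le
  omega

end Eigen

end TensorObstruction

end Literature.Algebra.Lie
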